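import Literature.Computability.Complexity.SOSCertificate
import Literature.Computability.Complexity.Mod2SosDegree
import Literature.Barriers.PneNP.TSPExtensionComplexityMatchingsOps
import HarnessLib

/-!
# Odd-cut inequalities of the perfect matching polytope have no low-degree SOS certificate:
# the restriction step (Braun–Brown-Cohen–Huq–Pokutta–Raghavendra–Roy–Weitz–Zink 2017, §4.5)

Let `n` be even and `U ⊆ [n]` a vertex set with `2|U| ≤ n`. The Edmonds odd-set (odd-cut)
slack `x(δ(U)) - 1` (`cutPoly U`, in the edge variables of `K_n`) is nonnegative on every perfect
matching of `K_n` when `|U|` is odd. BBCHPRRWZ (*The matching problem has no small symmetric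
SDP*, Math. Program. 165 (2017), §4.5, p. 10, proof of Thm. 4.11 from Thm. 4.10) reduce an SOS
certificate of such a slack from the matching constraints `𝒫_n` (the tree's `Mod2.system n`,
Grigoriev's `MOD2_n`) to an SOS REFUTATION of `𝒫_{|U|}` of the same degree, by the substitution
(verbatim): map the edge variables inside `U` to the variables of `K_{|U|}`, MIRROR a second
`|U|`-set `T ⊆ [n] ∖ U` onto the same variables, set the variables of a fixed perfect matching `W`
of the (even!) rest `[n] ∖ (U ∪ T)` to `1` and every other variable to `0`. Every equation of
`𝒫_n` goes to an equation of `𝒫_{|U|}` or to `0`, degrees do not grow, and `x(δ(U)) - 1 ↦ -1`.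

* `cutPoly U` — the odd-cut slack polynomial `x(δ(U)) - 1`;
* `OddCut.MirrorData n k` — the combinatorial data of the substitution (roles `ρ : [n] → (Fin k × Bool)?`
  bijective on each of the two classes, a perfect matching `W` of the role-less vertices),
  `OddCut.MirrorData.subst` the substitution, `…hasSOSRefutation` the transport
  (via `HasSOSCertificate.hasSOSRefutation_of_aeval_eq`, `SOSCertificate.lean`);
* `OddCut.exists_mirrorData` — the data exist for `n` even, `2|U| ≤ n`, `k = |U|`;
* `hasSOSRefutation_of_hasSOSCertificate_cutPoly` — **the restriction lemma**:
  `HasSOSCertificate (Mod2.system n) (cutPoly U) d → HasSOSRefutation (Mod2.system |U|) d`;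
* `oddCutRestriction` — the same in the binder shape of the cell's typed target
  `OddCutRestriction` (HOME/pnp-psdrank-p2/TARGET.md, Rung 1), and `oddCutSOSDegreeLinear_of` —
  Rung 1 `OddCutSOSDegreeLinear` from Grigoriev's named fact `Grigoriev2001_mod2Degree`
  ("Lasserre needs `Ω(|U|)` rounds to certify the odd-cut inequality of `U`").

## References

* G. Braun, J. Brown-Cohen, A. Huq, S. Pokutta, P. Raghavendra, A. Roy, B. Weitz, D. Zink,
  *The matching problem has no small symmetric SDP*, Math. Program. 165 (2017) 643–662, §4.5
  (arXiv:1504.00703, p. 10). [BraunEtAl2016]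
* D. Grigoriev, *Linear lower bound on degrees of Positivstellensatz calculus proofs for the
  parity*, Theoret. Comput. Sci. 259 (2001) 613–622, Cor. 2. [Grigoriev2001TCS]
-/

noncomputable section

open MvPolynomial Finset
open Literature.Barriers.PneNP (cutCount cutCount_mk IsPMOn exists_isPMOn_of_even)

namespace Literature.Computability.Complexity

/-! ### The odd-cut slack polynomial -/

/-- **The odd-cut slack polynomial** `x(δ(U)) - 1` of a vertex set `U ⊆ [n]` in the edge
variables of `K_n` (`δ(U)` = edges with exactly one endpoint in `U`, `cutCount U e = 1`). On the
indicator vector of a perfect matching `M` it takes the value `|M ∩ δ(U)| - 1`, the slack of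
Edmonds' odd-set inequality. [cite: BraunEtAl2016, §4.1–4.2 (the constraints x(δ(U)) ≥ 1, U odd)] -/
def cutPoly {n : ℕ} (U : Finset (Fin n)) : MvPolynomial (KnEdge n) ℝ :=
  (∑ e ∈ univ.filter (fun e : KnEdge n => cutCount U (e : Sym2 (Fin n)) = 1), X e) - 1

/-! ### Edges of `K_m` at a vertex -/

namespace KnEdge

variable {m : ℕ}

/-- The edge `{i, a}` of `K_m` for `a ≠ i`. [cite: Grigoriev2001TCS, p. 621 (the edges e ∋ i of K_n)] -/
def edgeAt (i : Fin m) (a : {a : Fin m // a ≠ i}) : KnEdge m :=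
  ⟨s(i, (a : Fin m)), by rw [Sym2.mk_isDiag_iff]; exact fun h => a.2 h.symm⟩

/-- Unfolding. [cite: Grigoriev2001TCS, p. 621 (the edges e ∋ i of K_n)] -/
@[simp] theorem coe_edgeAt (i : Fin m) (a : {a : Fin m // a ≠ i}) :
    ((edgeAt i a : KnEdge m) : Sym2 (Fin m)) = s(i, (a : Fin m)) := rfl

/-- `i ∈ {i, a}`. [cite: Grigoriev2001TCS, p. 621 (the edges e ∋ i of K_n)] -/
theorem mem_edgeAt (i : Fin m) (a : {a : Fin m // a ≠ i}) : i ∈ ((edgeAt i a : KnEdge m) : Sym2 (Fin m)) :=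
  Sym2.mem_mk_left _ _

/-- `a ↦ {i, a}` is injective. [cite: Grigoriev2001TCS, p. 621 (the edges e ∋ i of K_n)] -/
theorem edgeAt_injective (i : Fin m) : Function.Injective (edgeAt i) := by
  intro a b h
  have h' := congrArg (fun e : KnEdge m => (e : Sym2 (Fin m))) h
  exact Subtype.ext (Sym2.congr_right.1 h')

/-- **Summing over the edges at `i` = summing over the other endpoints** (the vertex sums
`Σ_{e ∋ i} X_e` of `MOD2`). [cite: Grigoriev2001TCS, p. 621 ("1 = Σ_{e ∋ i} X_e for each i")] -/
theorem sum_filter_mem {M : Type*} [AddCommMonoid M] (i : Fin m) (G : KnEdge m → M) :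
    ∑ e ∈ univ.filter (fun e : KnEdge m => i ∈ (e : Sym2 (Fin m))), G e =
      ∑ a : {a : Fin m // a ≠ i}, G (edgeAt i a) := by
  refine Finset.sum_bij'
    (fun e he => (⟨Sym2.Mem.other (mem_filter.1 he).2, Sym2.other_ne e.2 (mem_filter.1 he).2⟩ :
      {a : Fin m // a ≠ i}))
    (fun a _ => edgeAt i a) (fun _ _ => mem_univ _)
    (fun a _ => mem_filter.2 ⟨mem_univ _, mem_edgeAt i a⟩) ?_ ?_ ?_
  · intro e he
    exact Subtype.ext (Sym2.other_spec (mem_filter.1 he).2)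
  · intro a ha
    apply Subtype.ext
    exact Sym2.congr_right.1 (Sym2.other_spec (mem_filter.1 (mem_filter.2
      ⟨mem_univ _, mem_edgeAt i a⟩ : edgeAt i a ∈ univ.filter fun e : KnEdge m =>
        i ∈ (e : Sym2 (Fin m)))).2)
  · intro e he
    exact congrArg G (Subtype.ext (Sym2.other_spec (mem_filter.1 he).2)).symm

end KnEdge

/-! ### The mirror substitution -/

namespace OddCut

/-- **Data of the BBCHPRRWZ substitution.** Roles `ρ v ∈ (Fin k × Bool)?`: `some (x, false)` —
`v` is the vertex of `U` named `x`; `some (x, true)` — `v` is the vertex of the mirror set `T`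
named `x`; `none` — `v` lies in the rest. Each class is named bijectively by `Fin k` (`surj`,
`inj`), and `W` is a perfect matching of the rest (`pm`). [cite: BraunEtAl2016, §4.5 (p. 10)] -/
structure MirrorData (n k : ℕ) where
  /-- the role of a vertex -/
  ρ : Fin n → Option (Fin k × Bool)
  /-- the perfect matching of the role-less vertices -/
  W : Finset (Sym2 (Fin n))
  /-- every name is taken in each class -/
  surj : ∀ (β : Bool) (x : Fin k), ∃ v, ρ v = some (x, β)
  /-- names are unique within a class -/
  inj : ∀ {β : Bool} {x : Fin k} {v w : Fin n}, ρ v = some (x, β) → ρ w = some (x, β) → v = w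
  /-- `W` perfectly matches the role-less vertices -/
  pm : IsPMOn (univ.filter fun v => ρ v = none) W

namespace MirrorData

variable {n k : ℕ} (D : MirrorData n k)

/-- The value of an edge between vertices of roles `o`, `o'` (fallback `c`): the variable
`X_{x x'}` of `K_k` if both lie in the same class with names `x ≠ x'`, else `c`.
[cite: BraunEtAl2016, §4.5 (p. 10)] -/
def val (c : MvPolynomial (KnEdge k) ℝ) :
    Option (Fin k × Bool) → Option (Fin k × Bool) → MvPolynomial (KnEdge k) ℝ
  | some (x, β), some (x', β') =>
      if h : β = β' ∧ x ≠ x' then X ⟨s(x, x'), by rw [Sym2.mk_isDiag_iff]; exact h.2⟩ else c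
  | _, _ => c

/-- `val` is symmetric. [cite: BraunEtAl2016, §4.5 (p. 10)] -/
theorem val_comm (c : MvPolynomial (KnEdge k) ℝ) :
    ∀ o o' : Option (Fin k × Bool), val c o o' = val c o' o
  | some (x, β), some (x', β') => by
      simp only [val]
      by_cases h : β = β' ∧ x ≠ x'
      · have h' : β' = β ∧ x' ≠ x := ⟨h.1.symm, h.2.symm⟩
        rw [dif_pos h, dif_pos h']
        congr 1
        exact Subtype.ext Sym2.eq_swap
      · have h' : ¬ (β' = β ∧ x' ≠ x) := fun h' => h ⟨h'.1.symm, h'.2.symm⟩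
        rw [dif_neg h, dif_neg h']
  | none, some _ => rfl
  | some _, none => rfl
  | none, none => rfl

/-- **The substitution** `X_{ab} ↦ X_{x x'}` (same class, names `x, x'`), `↦ [ab ∈ W]` otherwise.
[cite: BraunEtAl2016, §4.5 (p. 10)] -/
def subst (e : KnEdge n) : MvPolynomial (KnEdge k) ℝ :=
  Sym2.lift ⟨fun a b => val (if (e : Sym2 (Fin n)) ∈ D.W then 1 else 0) (D.ρ a) (D.ρ b),
    fun _ _ => val_comm _ _ _⟩ (e : Sym2 (Fin n))

/-- Unfolding on a pair. [cite: BraunEtAl2016, §4.5 (p. 10)] -/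
theorem subst_mk (a b : Fin n) (h : ¬ (s(a, b) : Sym2 (Fin n)).IsDiag) :
    D.subst ⟨s(a, b), h⟩ = val (if s(a, b) ∈ D.W then 1 else 0) (D.ρ a) (D.ρ b) := rfl

/-- An edge of `W` joins two role-less vertices. [cite: BraunEtAl2016, §4.5 (p. 10)] -/
theorem eq_none_of_mem_W {a b : Fin n} (h : s(a, b) ∈ D.W) : D.ρ a = none ∧ D.ρ b = none := by
  have := Finset.mk_mem_sym2_iff.1 (D.pm.1 h)
  exact ⟨(mem_filter.1 this.1).2, (mem_filter.1 this.2).2⟩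

/-- **Same class**: the edge goes to the variable of the pair of names.
[cite: BraunEtAl2016, §4.5 (p. 10)] -/
theorem subst_of_same {a b : Fin n} (hab : ¬ (s(a, b) : Sym2 (Fin n)).IsDiag) {x y : Fin k}
    {β : Bool} (ha : D.ρ a = some (x, β)) (hb : D.ρ b = some (y, β)) :
    ∃ e' : KnEdge k, (e' : Sym2 (Fin k)) = s(x, y) ∧ D.subst ⟨s(a, b), hab⟩ = X e' := by
  have hxy : x ≠ y := by
    rintro rfl
    rw [Sym2.mk_isDiag_iff] at hab
    exact hab (D.inj ha hb)
  refine ⟨⟨s(x, y), by rw [Sym2.mk_isDiag_iff]; exact hxy⟩, rfl, ?_⟩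
  rw [subst_mk, ha, hb, val, dif_pos ⟨rfl, hxy⟩]

/-- **Different classes / role-less**: the edge goes to the constant `[ab ∈ W]`.
[cite: BraunEtAl2016, §4.5 (p. 10)] -/
theorem subst_of_not_same {a b : Fin n} (hab : ¬ (s(a, b) : Sym2 (Fin n)).IsDiag)
    (h : ∀ (x y : Fin k) (β : Bool), D.ρ a = some (x, β) → D.ρ b = some (y, β) → False) :
    D.subst ⟨s(a, b), hab⟩ = if s(a, b) ∈ D.W then 1 else 0 := by
  rw [subst_mk]
  rcases ha : D.ρ a with _ | ⟨x, β⟩ <;> rcases hb : D.ρ b with _ | ⟨y, β'⟩ <;> try rfl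
  rw [val, dif_neg]
  rintro ⟨rfl, -⟩
  exact h x y β ha hb

/-- A classed vertex joined to a vertex outside its class: the edge goes to `0`.
[cite: BraunEtAl2016, §4.5 (p. 10)] -/
theorem subst_eq_zero_of_some {a b : Fin n} (hab : ¬ (s(a, b) : Sym2 (Fin n)).IsDiag)
    {x : Fin k} {β : Bool} (ha : D.ρ a = some (x, β)) (hb : ∀ y, D.ρ b ≠ some (y, β)) :
    D.subst ⟨s(a, b), hab⟩ = 0 := by
  rw [D.subst_of_not_same hab fun x' y β' ha' hb' => ?_]
  · rw [if_neg]
    intro hW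
    have := (D.eq_none_of_mem_W hW).1
    rw [ha] at this
    exact Option.some_ne_none _ this
  · rw [ha] at ha'
    obtain ⟨rfl, rfl⟩ := Option.some.inj ha' ▸ (rfl : (x, β) = (x, β))
    cases ha'
    exact hb y hb'

/-- The same with the roles of the endpoints exchanged. [cite: BraunEtAl2016, §4.5 (p. 10)] -/
theorem subst_eq_zero_of_some' {a b : Fin n} (hab : ¬ (s(a, b) : Sym2 (Fin n)).IsDiag)
    {y : Fin k} {β : Bool} (hb : D.ρ b = some (y, β)) (ha : ∀ x, D.ρ a ≠ some (x, β)) :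
    D.subst ⟨s(a, b), hab⟩ = 0 := by
  have hba : ¬ (s(b, a) : Sym2 (Fin n)).IsDiag := by rwa [Sym2.eq_swap]
  have : (⟨s(a, b), hab⟩ : KnEdge n) = ⟨s(b, a), hba⟩ := Subtype.ext Sym2.eq_swap
  rw [this]
  exact D.subst_eq_zero_of_some hba hb ha

/-- A role-less endpoint: the edge goes to `[ab ∈ W]`. [cite: BraunEtAl2016, §4.5 (p. 10)] -/
theorem subst_of_none {a b : Fin n} (hab : ¬ (s(a, b) : Sym2 (Fin n)).IsDiag) (ha : D.ρ a = none) :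
    D.subst ⟨s(a, b), hab⟩ = if s(a, b) ∈ D.W then 1 else 0 :=
  D.subst_of_not_same hab fun _ _ _ ha' _ => Option.some_ne_none _ (ha ▸ ha').symm

/-- **Degrees**: every substituted variable is a variable or a constant.
[cite: BraunEtAl2016, §4.5 (p. 10, "does not increase the degree")] -/
theorem totalDegree_subst_le_one (e : KnEdge n) : (D.subst e).totalDegree ≤ 1 := by
  obtain ⟨e, he⟩ := e
  induction e using Sym2.ind with
  | _ a b =>
    rw [subst_mk]
    have hc : (if s(a, b) ∈ D.W then (1 : MvPolynomial (KnEdge k) ℝ) else 0).totalDegree ≤ 1 := by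
      split_ifs <;> simp
    rcases D.ρ a with _ | ⟨x, β⟩ <;> rcases D.ρ b with _ | ⟨y, β'⟩ <;> try exact hc
    rw [val]
    by_cases h : β = β' ∧ x ≠ y
    · rw [dif_pos h]
      exact (totalDegree_X _).le
    · rw [dif_neg h]
      exact hc

/-! ### The images of the equations of `MOD2_n` -/

/-- The named vertex `x` of class `β`. [cite: BraunEtAl2016, §4.5 (p. 10)] -/
def vert (β : Bool) (x : Fin k) : Fin n := Classical.choose (D.surj β x)

/-- Its role. [cite: BraunEtAl2016, §4.5 (p. 10)] -/
theorem ρ_vert (β : Bool) (x : Fin k) : D.ρ (D.vert β x) = some (x, β) :=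
  Classical.choose_spec (D.surj β x)

/-- **Boolean axioms** go to Boolean axioms or to `0`. [cite: BraunEtAl2016, §4.5 (p. 10)] -/
theorem aeval_system_edge (e : KnEdge n) :
    aeval D.subst (Mod2.system n (Sum.inl e)) = 0 ∨
      ∃ ι', aeval D.subst (Mod2.system n (Sum.inl e)) = Mod2.system k ι' := by
  obtain ⟨e, he⟩ := e
  induction e using Sym2.ind with
  | _ a b =>
    simp only [Mod2.system_edge, map_sub, map_pow, aeval_X]
    by_cases h : ∃ (x y : Fin k) (β : Bool), D.ρ a = some (x, β) ∧ D.ρ b = some (y, β)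
    · obtain ⟨x, y, β, ha, hb⟩ := h
      obtain ⟨e', -, he'⟩ := D.subst_of_same he ha hb
      exact Or.inr ⟨Sum.inl e', by rw [he', Mod2.system_edge]⟩
    · left
      rw [D.subst_of_not_same he fun x y β ha hb => h ⟨x, y, β, ha, hb⟩]
      split_ifs <;> ring

/-- An edge through `i` is `{i, a}` for the other endpoint `a`. [cite: Grigoriev2001TCS, p. 621 (the edges e ∋ i of K_n)] -/
theorem exists_eq_edgeAt {m : ℕ} {i : Fin m} {e : KnEdge m} (h : i ∈ (e : Sym2 (Fin m))) :
    ∃ a : {a : Fin m // a ≠ i}, e = KnEdge.edgeAt i a :=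
  ⟨⟨Sym2.Mem.other h, Sym2.other_ne e.2 h⟩, Subtype.ext (Sym2.other_spec h).symm⟩

/-- **Disjointness equations** go to disjointness equations or to `0`.
[cite: BraunEtAl2016, §4.5 (p. 10)] -/
theorem aeval_system_pair
    (p : {p : KnEdge n × KnEdge n //
      p.1 ≠ p.2 ∧ ∃ i : Fin n, i ∈ (p.1 : Sym2 (Fin n)) ∧ i ∈ (p.2 : Sym2 (Fin n))}) :
    aeval D.subst (Mod2.system n (Sum.inr (Sum.inl p))) = 0 ∨
      ∃ ι', aeval D.subst (Mod2.system n (Sum.inr (Sum.inl p))) = Mod2.system k ι' := by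
  obtain ⟨⟨e, f⟩, hne, i, hie, hif⟩ := p
  obtain ⟨a, rfl⟩ := exists_eq_edgeAt hie
  obtain ⟨b, rfl⟩ := exists_eq_edgeAt hif
  have hab : (a : Fin n) ≠ b := by
    intro h
    apply hne
    change KnEdge.edgeAt i a = KnEdge.edgeAt i b
    rw [Subtype.ext h]
  simp only [Mod2.system_pair, map_mul, aeval_X]
  rcases hi : D.ρ i with _ | ⟨j, β⟩
  · -- `i` role-less: two distinct `W`-edges at `i` are impossible
    left
    rw [KnEdge.edgeAt, KnEdge.edgeAt, D.subst_of_none _ hi, D.subst_of_none _ hi]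
    by_cases ha : s(i, (a : Fin n)) ∈ D.W
    · by_cases hb : s(i, (b : Fin n)) ∈ D.W
      · exfalso
        have h1 := D.pm.2.2 i (mem_filter.2 ⟨mem_univ _, hi⟩)
        have h2 : ({s(i, (a : Fin n)), s(i, (b : Fin n))} : Finset (Sym2 (Fin n))) ⊆
            D.W.filter fun e => i ∈ e := by
          intro e he
          simp only [mem_insert, mem_singleton] at he
          rcases he with rfl | rfl
          · exact mem_filter.2 ⟨ha, Sym2.mem_mk_left _ _⟩
          · exact mem_filter.2 ⟨hb, Sym2.mem_mk_left _ _⟩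
        have h3 := card_le_card h2
        rw [h1, card_pair fun h => hab (Sym2.congr_right.1 h)] at h3
        omega
      · rw [if_neg hb, mul_zero]
    · rw [if_neg ha, zero_mul]
  · by_cases ha : ∃ x, D.ρ a = some (x, β)
    · by_cases hb : ∃ y, D.ρ b = some (y, β)
      · obtain ⟨x, ha⟩ := ha
        obtain ⟨y, hb⟩ := hb
        obtain ⟨e', he'v, he'⟩ := D.subst_of_same (KnEdge.edgeAt i a).2 hi ha
        obtain ⟨f', hf'v, hf'⟩ := D.subst_of_same (KnEdge.edgeAt i b).2 hi hb
        have hxy : x ≠ y := by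
          rintro rfl
          exact hab (D.inj ha hb)
        have hnef : e' ≠ f' := by
          intro h
          have := congrArg (fun e : KnEdge k => (e : Sym2 (Fin k))) h
          simp only [he'v, hf'v] at this
          exact hxy (Sym2.congr_right.1 this)
        refine Or.inr ⟨Sum.inr (Sum.inl ⟨(e', f'), hnef, j, ?_, ?_⟩), ?_⟩
        · rw [he'v]; exact Sym2.mem_mk_left _ _
        · rw [hf'v]; exact Sym2.mem_mk_left _ _
        · rw [Mod2.system_pair]
          change D.subst (KnEdge.edgeAt i a) * D.subst (KnEdge.edgeAt i b) = X e' * X f'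
          rw [show D.subst (KnEdge.edgeAt i a) = X e' from he',
            show D.subst (KnEdge.edgeAt i b) = X f' from hf']
      · left
        push Not at hb
        rw [show D.subst (KnEdge.edgeAt i b) = 0 from D.subst_eq_zero_of_some _ hi hb, mul_zero]
    · left
      push Not at ha
      rw [show D.subst (KnEdge.edgeAt i a) = 0 from D.subst_eq_zero_of_some _ hi ha, zero_mul]

/-- The `W`-edges at a role-less vertex `i`, as edges of `K_n`: exactly one.
[cite: BraunEtAl2016, §4.5 (p. 10)] -/
theorem sum_indicator_W_eq_one {i : Fin n} (hi : D.ρ i = none) :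
    ∑ a : {a : Fin n // a ≠ i},
      (if s(i, (a : Fin n)) ∈ D.W then (1 : MvPolynomial (KnEdge k) ℝ) else 0) = 1 := by
  rw [← Finset.sum_filter, sum_const, nsmul_eq_mul, mul_one]
  have hcard : (univ.filter fun a : {a : Fin n // a ≠ i} => s(i, (a : Fin n)) ∈ D.W).card =
      (D.W.filter fun e => i ∈ e).card := by
    refine card_bij' (fun a _ => s(i, (a : Fin n)))
      (fun e he => ⟨Sym2.Mem.other (mem_filter.1 he).2,
        Sym2.other_ne (D.pm.2.1 e (mem_filter.1 he).1) (mem_filter.1 he).2⟩)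
      (fun a ha => mem_filter.2 ⟨(mem_filter.1 ha).2, Sym2.mem_mk_left _ _⟩)
      (fun e he => mem_filter.2 ⟨mem_univ _, by
        rw [Sym2.other_spec (mem_filter.1 he).2]; exact (mem_filter.1 he).1⟩)
      (fun a ha => Subtype.ext (Sym2.congr_right.1 (Sym2.other_spec _)))
      (fun e he => Sym2.other_spec (mem_filter.1 he).2)
  rw [hcard, D.pm.2.2 i (mem_filter.2 ⟨mem_univ _, hi⟩), Nat.cast_one]

/-- **Vertex equations** of role-less vertices go to `0`: exactly one `W`-edge, all other
edges at `i` go to `0`. [cite: BraunEtAl2016, §4.5 (p. 10)] -/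
theorem aeval_system_vertex_none {i : Fin n} (hi : D.ρ i = none) :
    aeval D.subst (Mod2.system n (Sum.inr (Sum.inr i))) = 0 := by
  rw [Mod2.system_vertex, map_sub, map_one, map_sum, KnEdge.sum_filter_mem, sub_eq_zero]
  simp_rw [aeval_X]
  rw [← D.sum_indicator_W_eq_one hi]
  exact sum_congr rfl fun a _ => D.subst_of_none _ hi

/-- **Vertex equations** of a classed vertex go to the vertex equation of its name: the edges
to the other vertices of its class go to the corresponding variables, bijectively, and all other
edges at it go to `0`. [cite: BraunEtAl2016, §4.5 (p. 10)] -/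
theorem aeval_system_vertex_some {i : Fin n} {j : Fin k} {β : Bool} (hi : D.ρ i = some (j, β)) :
    aeval D.subst (Mod2.system n (Sum.inr (Sum.inr i))) = Mod2.system k (Sum.inr (Sum.inr j)) := by
  rw [Mod2.system_vertex, Mod2.system_vertex, map_sub, map_one, map_sum, KnEdge.sum_filter_mem,
    KnEdge.sum_filter_mem]
  simp_rw [aeval_X]
  congr 1
  -- drop the edges leaving the class of `i`
  rw [← Finset.sum_filter_of_ne (p := fun a : {a : Fin n // a ≠ i} => ∃ x, D.ρ a = some (x, β))
    (fun a _ hne => by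
      by_contra h
      push Not at h
      exact hne (D.subst_eq_zero_of_some _ hi h))]
  -- reindex by names
  symm
  refine Finset.sum_bij (fun y _ => (⟨D.vert β y, fun h => y.2 ?_⟩ : {a : Fin n // a ≠ i}))
    (fun y _ => mem_filter.2 ⟨mem_univ _, y, D.ρ_vert β y⟩) ?_ ?_ ?_
  · -- `vert β y ≠ i` since `y ≠ j`
    have := D.ρ_vert β y
    rw [h, hi] at this
    exact (Prod.mk.inj (Option.some.inj this)).1.symm
  · intro y₁ _ y₂ _ h
    have h' : D.ρ (D.vert β y₁) = D.ρ (D.vert β y₂) :=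
      congrArg (fun a : {a : Fin n // a ≠ i} => D.ρ (a : Fin n)) h
    rw [D.ρ_vert, D.ρ_vert] at h'
    exact Subtype.ext (Prod.mk.inj (Option.some.inj h')).1
  · intro a ha
    obtain ⟨x, hx⟩ := (mem_filter.1 ha).2
    have hxj : x ≠ j := by
      rintro rfl
      exact a.2 (D.inj hx hi)
    exact ⟨⟨x, hxj⟩, mem_univ _, Subtype.ext (D.inj (D.ρ_vert β x) hx)⟩
  · intro y _
    obtain ⟨e', he'v, he'⟩ := D.subst_of_same (KnEdge.edgeAt i ⟨D.vert β y, _⟩).2 hi (D.ρ_vert β y)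
    have : e' = KnEdge.edgeAt j y := Subtype.ext he'v
    rw [← this]
    exact he'.symm

/-- **Every equation of `MOD2_n` goes to an equation of `MOD2_k` or to `0`.**
[cite: BraunEtAl2016, §4.5 (p. 10, "maps 𝒫_n into 𝒫_{n'} ∪ {0}")] -/
theorem aeval_system (ι : Mod2.Idx n) :
    aeval D.subst (Mod2.system n ι) = 0 ∨ ∃ ι', aeval D.subst (Mod2.system n ι) = Mod2.system k ι' := by
  rcases ι with e | p | i
  · exact D.aeval_system_edge e
  · exact D.aeval_system_pair p
  · rcases hi : D.ρ i with _ | ⟨j, β⟩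
    · exact Or.inl (D.aeval_system_vertex_none hi)
    · exact Or.inr ⟨_, D.aeval_system_vertex_some hi⟩

/-- **Transport**: an SOS certificate from `MOD2_n` of a polynomial that the substitution sends
to `-1` yields an SOS refutation of `MOD2_k` of the same half-degree.
[cite: BraunEtAl2016, §4.5 (p. 10)] -/
theorem hasSOSRefutation {p : MvPolynomial (KnEdge n) ℝ} {d : ℕ}
    (h : HasSOSCertificate (Mod2.system n) p d) (hp : aeval D.subst p = -1) :
    HasSOSRefutation (Mod2.system k) d :=
  h.hasSOSRefutation_of_aeval_eq D.subst D.totalDegree_subst_le_one D.aeval_system hp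

/-- **The odd-cut slack goes to `-1`**: every edge of `δ(U)`, `U` = the class `false`, joins a
`U`-vertex to a non-`U`-vertex and is sent to `0`. [cite: BraunEtAl2016, §4.5 (p. 10)] -/
theorem aeval_cutPoly {U : Finset (Fin n)} (hU : ∀ v, v ∈ U ↔ ∃ x, D.ρ v = some (x, false)) :
    aeval D.subst (cutPoly U) = -1 := by
  rw [cutPoly, map_sub, map_one, map_sum]
  simp_rw [aeval_X]
  rw [sum_eq_zero, zero_sub]
  rintro ⟨e, he⟩ hmem
  replace hmem := (mem_filter.1 hmem).2
  revert he hmem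
  induction e using Sym2.ind with
  | _ a b =>
    intro he hcut
    change cutCount U s(a, b) = 1 at hcut
    rw [cutCount_mk] at hcut
    by_cases ha : a ∈ U
    · have hb : b ∉ U := fun hb => by rw [if_pos ha, if_pos hb] at hcut; exact absurd hcut (by norm_num)
      obtain ⟨x, hx⟩ := (hU a).1 ha
      exact D.subst_eq_zero_of_some he hx fun y hy => hb ((hU b).2 ⟨y, hy⟩)
    · have hb : b ∈ U := by
        by_contra hb
        rw [if_neg ha, if_neg hb] at hcut
        exact absurd hcut (by norm_num)
      obtain ⟨y, hy⟩ := (hU b).1 hb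
      exact D.subst_eq_zero_of_some' he hy fun x hx => ha ((hU a).2 ⟨x, hx⟩)

end MirrorData

/-- **The mirror data exist** for even `n` and `2|U| ≤ n`: a `|U|`-set `T` disjoint from `U`
(room since `2|U| ≤ n`), names `U ≃ Fin |U| ≃ T`, and a perfect matching of the remaining
`n - 2|U|` (even) vertices. [cite: BraunEtAl2016, §4.5 (p. 10, "W ⊆ E[2n - 4m']")] -/
theorem exists_mirrorData {n : ℕ} (hn : Even n) (U : Finset (Fin n)) (h2 : 2 * U.card ≤ n) :
    ∃ D : MirrorData n U.card, ∀ v, v ∈ U ↔ ∃ x, D.ρ v = some (x, false) := by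
  classical
  -- the mirror set
  obtain ⟨T, hTsub, hTcard⟩ : ∃ T ⊆ univ \ U, T.card = U.card :=
    exists_subset_card_eq (by
      rw [card_sdiff_of_subset (subset_univ U), card_univ, Fintype.card_fin]; omega)
  have hdisj : ∀ v, v ∈ T → v ∉ U := fun v hv => (mem_sdiff.1 (hTsub hv)).2
  let eU : ↥U ≃ Fin U.card := U.equivFin
  let eT : ↥T ≃ Fin U.card := Finset.equivFinOfCardEq hTcard
  let ρ : Fin n → Option (Fin U.card × Bool) := fun v =>
    if h : v ∈ U then some (eU ⟨v, h⟩, false)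
    else if h' : v ∈ T then some (eT ⟨v, h'⟩, true) else none
  have hρU : ∀ {v x β}, ρ v = some (x, β) → β = false → ∃ h : v ∈ U, eU ⟨v, h⟩ = x := by
    intro v x β h hβ
    subst hβ
    simp only [ρ] at h
    split_ifs at h with h1 h2
    · exact ⟨h1, by simpa using h⟩
    · simp at h
  have hρT : ∀ {v x β}, ρ v = some (x, β) → β = true → ∃ h : v ∈ T, eT ⟨v, h⟩ = x := by
    intro v x β h hβ
    subst hβ
    simp only [ρ] at h
    split_ifs at h with h1 h2
    · simp at h
    · exact ⟨h2, by simpa using h⟩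
  -- the rest and its perfect matching
  have hR : (univ.filter fun v => ρ v = none) = (univ \ U) \ T := by
    ext v
    simp only [mem_filter, mem_univ, true_and, mem_sdiff, ρ]
    split_ifs with h1 h2 <;> simp [h1, h2]
  have hRcard : (univ.filter fun v => ρ v = none).card = n - 2 * U.card := by
    rw [hR, card_sdiff_of_subset hTsub, card_sdiff_of_subset (subset_univ U), card_univ,
      Fintype.card_fin, hTcard]
    omega
  have hReven : Even (n - 2 * U.card) := by
    obtain ⟨a, ha⟩ := hn
    exact ⟨a - U.card, by omega⟩
  obtain ⟨W, hW⟩ := exists_isPMOn_of_even _ _ hRcard hReven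
  have hsurj : ∀ (β : Bool) (x : Fin U.card), ∃ v, ρ v = some (x, β) := by
    rintro (_ | _) x
    · refine ⟨(eU.symm x : ↥U), ?_⟩
      simp [ρ, (eU.symm x).2]
    · refine ⟨(eT.symm x : ↥T), ?_⟩
      have h1 : ((eT.symm x : ↥T) : Fin n) ∉ U := hdisj _ (eT.symm x).2
      simp [ρ, h1, (eT.symm x).2]
  have hinj : ∀ {β : Bool} {x : Fin U.card} {v w : Fin n},
      ρ v = some (x, β) → ρ w = some (x, β) → v = w := by
    rintro (_ | _) x v w hv hw
    · obtain ⟨hv', hxv⟩ := hρU hv rfl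
      obtain ⟨hw', hxw⟩ := hρU hw rfl
      have := eU.injective (hxv.trans hxw.symm)
      exact congrArg Subtype.val this
    · obtain ⟨hv', hxv⟩ := hρT hv rfl
      obtain ⟨hw', hxw⟩ := hρT hw rfl
      have := eT.injective (hxv.trans hxw.symm)
      exact congrArg Subtype.val this
  refine ⟨⟨ρ, W, hsurj, hinj, hW⟩, fun v => ⟨fun hv => ⟨eU ⟨v, hv⟩, by simp [ρ, hv]⟩, fun h => ?_⟩⟩
  obtain ⟨x, hx⟩ := h
  exact (hρU hx rfl).1

end OddCut

/-! ### The restriction lemma and Rung 1 -/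

/-- **Restriction lemma (BBCHPRRWZ §4.5).** For even `n` and `U ⊆ [n]` with `2|U| ≤ n`, an SOS
certificate of the odd-cut slack `x(δ(U)) - 1` from the matching constraints of `K_n` of
half-degree `d` yields an SOS refutation of the matching constraints of `K_{|U|}` (`MOD2_{|U|}`)
of half-degree `d`. [cite: BraunEtAl2016, §4.5 (p. 10)] -/
theorem hasSOSRefutation_of_hasSOSCertificate_cutPoly {n : ℕ} (hn : Even n) (U : Finset (Fin n))
    (h2 : 2 * U.card ≤ n) {d : ℕ} (h : HasSOSCertificate (Mod2.system n) (cutPoly U) d) :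
    HasSOSRefutation (Mod2.system U.card) d := by
  obtain ⟨D, hD⟩ := OddCut.exists_mirrorData hn U h2
  exact D.hasSOSRefutation h (D.aeval_cutPoly hD)

/-- **`OddCutRestriction`** (the cell's typed Rung-1 lemma, HOME/pnp-psdrank-p2/TARGET.md, in its
binder shape; the oddness of `|U|` is not needed for the restriction itself).
[cite: BraunEtAl2016, §4.5 (p. 10)] -/
theorem oddCutRestriction :
    ∀ n : ℕ, Even n → ∀ U : Finset (Fin n), Odd U.card → 2 * U.card ≤ n → ∀ d : ℕ,
      HasSOSCertificate (Mod2.system n) (cutPoly U) d → HasSOSRefutation (Mod2.system U.card) d :=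
  fun _ hn U _ h2 _ h => hasSOSRefutation_of_hasSOSCertificate_cutPoly hn U h2 h

/-- **Rung 1 / `OddCutSOSDegreeLinear` from Grigoriev's bound (`OddCutAssembly`).** If SOS needs
degree `≥ c·m` to refute `MOD2_m` (`m ≥ n₀`; the named fact `Grigoriev2001_mod2Degree`,
Grigoriev 2001 Cor. 2), then for even `n` and odd `U ⊆ [n]` with `n₀ ≤ |U|`, `2|U| ≤ n`, every SOS
certificate of the odd-cut inequality `x(δ(U)) ≥ 1` from the matching constraints of `K_n` has
degree `2d ≥ c·|U|` — the Lasserre hierarchy over `𝒫_n` needs `Ω(n)` rounds to imply the odd-set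
inequalities of the perfect matching polytope. [cite: BraunEtAl2016, Thm. 4.11 with §4.5] -/
theorem oddCutSOSDegreeLinear_of (hG : Grigoriev2001_mod2Degree) :
    ∃ c : ℝ, 0 < c ∧ ∃ t₀ : ℕ, ∀ n : ℕ, Even n → ∀ U : Finset (Fin n), Odd U.card → t₀ ≤ U.card →
      2 * U.card ≤ n → ∀ d : ℕ, HasSOSCertificate (Mod2.system n) (cutPoly U) d →
        c * U.card ≤ 2 * d := by
  obtain ⟨c, hc, n₀, H⟩ := hG
  exact ⟨c, hc, n₀, fun n hn U _ ht h2 d h =>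
    H _ ht d (hasSOSRefutation_of_hasSOSCertificate_cutPoly hn U h2 h)⟩

end Literature.Computability.Complexity
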